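import Summits.QuantumAdvantage.QuantumAdvantage.Theorems.NearExactIsExact.Negative.LevelSixSixtyOnePrep
import Summits.QuantumAdvantage.QuantumAdvantage.Theorems.CubicForrelationNearExactIsExactFourteenSecondStructure
import Summits.QuantumAdvantage.QuantumAdvantage.Theorems.CubicForrelationNearExactIsExactFourierPeriods
import Summits.QuantumAdvantage.QuantumAdvantage.Theorems.CubicForrelationNearExactIsExactEightSymplectic

/-!
# No TIGHT level-6 side at `Φ = 61/64` on 14 bits — engine (NearExactIsExact, disprover gen 24)
Negative/structural lemmas for the crux `CubicForrelation.NearExactIsExact` (item r2), finite slice `n = 14`.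
HONEST FRAMING: statements about cubic Boolean functions on 14 bits — NOT summit progress; no violation of `NearExactIsExact`.
After `…Negative.LevelSixMinimalSixtyOne` the only level-6 configuration left at `Φ ≥ 61/64` is the TIGHT one: `W_g = 64u'`,
odd set `P = {u' odd}` of size `6144 = 2¹³ − 2¹¹` (a quadratic of rank 4), residual `e = u' − 2(−1)^f` equal to `±1` on `P` and `0`
off `P`.  This file kills it through the Fourier `ℓ¹`-norm of `e`:
* `lsf_radical`: a quadratic `q` on 14 bits of weight `6144` has a radical `R` (`B_q(a,·) ≡ 0`) of size EXACTLY `2¹⁰`, all of whose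
  vectors are periods of `q` (bias² `= 2¹⁴·Σ_{a∈R}(−1)^{q(0)⊕q(a)}`, and the character sum over the subspace `R` is `0` or `#R`);
* `lsf_mul`: for `p ∈ P` and `r, r' ∈ R`, `e(p⊕r⊕r')e(p) = e(p⊕r)e(p⊕r')` — the 4-flat `p ⊕ ⟨t,t',r,r'⟩` with its twelve
  `t`-translates off `P` (pigeonhole, `#P̄ = 10240 > 2¹³`) has `4 ∣ Σ u'` (`fs_flat_sum_dvd`), i.e. `4 ∣` the four residuals on `P`;
* `lsf_l1`: hence on every coset `p ⊕ R ⊆ P` the residual is a `±`character up to sign, each `e·1_{p⊕R}` has `Σ_y |·̂| ≤ 2¹⁴`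
  (`fp_l1_sq_mul_le`), and averaging over `p ∈ P` (each point of `P` lies on `2¹⁰` such cosets) `Σ_y |ê(y)| ≤ 6·2¹⁴`.
The contradiction (`Σ_y (−1)^{g(y)} ê(y) = 2²²(1 − Φ) = 3·2¹⁶ > 6·2¹⁴`) is drawn in `…Negative.LevelSixFullSixtyOne`.
References: R. O'Donnell (2014) §3.3; F. J. MacWilliams, N. J. A. Sloane (1977) Ch. 15 §2.  Standard axioms only. -/

set_option linter.dupNamespace false -- D-0017: single-problem summit ⇒ `QuantumAdvantage.QuantumAdvantage` by design
noncomputable section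
namespace Summit.QuantumAdvantage.QuantumAdvantage.Theorems.NearExactIsExact.Negative.LevelSixFullCore
open Finset
open Literature.Computability.QuantumComplexity
open Literature.Computability.QuantumComplexity.BuzetChailloux (bxor zeroVec bxor_bxor_cancel_left bxor_zeroVec zeroVec_bxor bxor_comm
  bxor_self signOf_sq)
open Literature.Computability.QuantumComplexity.DerivativeWalsh (W sum_W_sq twist_bxor_left sum_char_subspace)
open Summit.QuantumAdvantage.QuantumAdvantage.Theorems.CubicForrelation.NearExactIsExact
open Summit.QuantumAdvantage.QuantumAdvantage.Theorems.CubicForrelation.ExactPairsMaioranaMcFarland (dv_bxor_right_comm)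
open Summit.QuantumAdvantage.QuantumAdvantage.Theorems.NearExactIsExact.Negative.LevelSixSixtyOnePrep

/-! ### The radical of a weight-`6144` quadratic on 14 bits -/

set_option maxHeartbeats 800000 in
/-- **Radical of a rank-4 quadratic.**  For `q` of degree `≤ 2` on 14 bits with `#{q = 1} = 6144`, the radical
`R = {a : B_q(a,·) ≡ 0}` has exactly `2¹⁰` elements and every `a ∈ R` is a period of `q`.
(`(Σ(−1)^q)² = Σ_a Σ_x (−1)^{q(x)⊕q(x⊕a)} = 2¹⁴ Σ_{a∈R} (−1)^{q(0)⊕q(a)}`, the inner sum vanishing off `R` by the translation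
`x ↦ x ⊕ b` with `B(a,b) = 1`; the bias is `2¹⁴ − 2·6144 = 2¹²`, so the character sum `Σ_{a∈R}(−1)^{q(0)⊕q(a)}` is `2¹⁰`, hence
equal to `#R` with all signs `+`.) [cite: MacWilliamsSloane1977, Ch. 15 §2] -/
theorem lsf_radical (q : (Fin (7 + 7) → Bool) → Bool) (hq : IsDegLeFun 2 q)
    (hcard : #(univ.filter fun x : Fin (7 + 7) → Bool => q x = true) = 6144) :
    zeroVec ∈ (univ.filter fun a : Fin (7 + 7) → Bool => ∀ b, (q zeroVec ^^ q a ^^ q b ^^ q (bxor a b)) = false) ∧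
    (∀ a ∈ (univ.filter fun a : Fin (7 + 7) → Bool => ∀ b, (q zeroVec ^^ q a ^^ q b ^^ q (bxor a b)) = false),
      ∀ a' ∈ (univ.filter fun a : Fin (7 + 7) → Bool => ∀ b, (q zeroVec ^^ q a ^^ q b ^^ q (bxor a b)) = false),
        bxor a a' ∈ (univ.filter fun a : Fin (7 + 7) → Bool => ∀ b, (q zeroVec ^^ q a ^^ q b ^^ q (bxor a b)) = false)) ∧
    #(univ.filter fun a : Fin (7 + 7) → Bool => ∀ b, (q zeroVec ^^ q a ^^ q b ^^ q (bxor a b)) = false) = 1024 ∧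
    ∀ a ∈ (univ.filter fun a : Fin (7 + 7) → Bool => ∀ b, (q zeroVec ^^ q a ^^ q b ^^ q (bxor a b)) = false),
      ∀ x, q (bxor x a) = q x := by
  classical
  set R := univ.filter (fun a : Fin (7 + 7) → Bool => ∀ b, (q zeroVec ^^ q a ^^ q b ^^ q (bxor a b)) = false) with hRdef
  have hmemR : ∀ a, a ∈ R ↔ ∀ b, (q zeroVec ^^ q a ^^ q b ^^ q (bxor a b)) = false := fun a => by simp [hRdef]
  let s : (Fin (7 + 7) → Bool) → ℝ := fun x => signOf (q x)
  have hsgn : ∀ b : Bool, signOf b = 1 - 2 * (if b = true then (1 : ℝ) else 0) := by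
    intro b; cases b <;> simp [signOf]; norm_num
  have hbias : ∑ x, s x = 4096 := by
    simp only [s, hsgn]
    rw [sum_sub_distrib, sum_const, card_univ, Fintype.card_fun, Fintype.card_bool, Fintype.card_fin, ← mul_sum, sum_boole, hcard]
    norm_num
  have hDsum : ∑ a, ∑ x, s x * s (bxor x a) = 4096 * 4096 := by
    rw [sum_comm]
    have e : ∀ x : Fin (7 + 7) → Bool, ∑ a, s x * s (bxor x a) = s x * ∑ z, s z := by
      intro x
      rw [mul_sum]
      exact Fintype.sum_equiv (Equiv.mk (fun a => bxor x a) (fun z => bxor x z)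
        (fun a => by simp [bxor_bxor_cancel_left]) (fun z => by simp [bxor_bxor_cancel_left])) _ _ (fun a => rfl)
    rw [sum_congr rfl fun x _ => e x, ← sum_mul, hbias]
  have hper0 : ∀ a ∈ R, ∀ x, q (bxor x a) = (q x ^^ (q zeroVec ^^ q a)) := by
    intro a ha x
    have h := es_second_deriv q hq zeroVec a x
    rw [zeroVec_bxor, zeroVec_bxor, (hmemR a).1 ha x, bxor_comm a x] at h
    rw [h]
    cases q zeroVec <;> cases q a <;> cases q x <;> rfl
  have hDon : ∀ a ∈ R, ∑ x, s x * s (bxor x a) = 16384 * signOf (q zeroVec ^^ q a) := by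
    intro a ha
    have e : ∀ x, s x * s (bxor x a) = signOf (q zeroVec ^^ q a) := by
      intro x
      simp only [s]
      rw [hper0 a ha x, signOf_xor, ← mul_assoc, ← pow_two, signOf_sq, one_mul]
    rw [sum_congr rfl fun x _ => e x, sum_const, card_univ, Fintype.card_fun, Fintype.card_bool, Fintype.card_fin]
    norm_num
  have hDoff : ∀ a, a ∉ R → ∑ x, s x * s (bxor x a) = 0 := by
    intro a ha
    rw [hmemR] at ha
    push Not at ha
    obtain ⟨b, hb⟩ := ha
    have hb' : (q zeroVec ^^ q a ^^ q b ^^ q (bxor a b)) = true := by simpa using hb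
    -- re-index by `x ↦ x ⊕ b`
    have hre : ∑ x, s x * s (bxor x a) = ∑ x, s (bxor x b) * s (bxor (bxor x b) a) :=
      (Fintype.sum_equiv (Equiv.mk (fun x => bxor x b) (fun x => bxor x b)
        (fun x => by simp [iw_bxor_assoc]) (fun x => by simp [iw_bxor_assoc])) _ _ (fun x => rfl)).symm
    have e : ∀ x, s (bxor x b) * s (bxor (bxor x b) a) = -(s x * s (bxor x a)) := by
      intro x
      have hb'' : (q zeroVec ^^ q b ^^ q a ^^ q (bxor a b)) = true := by
        revert hb'; cases q zeroVec <;> cases q a <;> cases q b <;> cases q (bxor a b) <;> decide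
      have h := es_second_deriv q hq x b a
      rw [bxor_comm b a, hb''] at h
      simp only [s]
      rw [h, signOf_xor, signOf_xor, signOf_xor]
      have h1 : signOf (q (bxor x b)) * signOf (q (bxor x b)) = 1 := by rw [← pow_two, signOf_sq]
      have h2 : signOf true = -1 := by simp [signOf]
      rw [h2]
      linear_combination (signOf (q x) * signOf (q (bxor x a)) * (-1)) * h1
    rw [sum_congr rfl fun x _ => e x, sum_neg_distrib] at hre
    linarith
  have hchar : ∑ a ∈ R, signOf (q zeroVec ^^ q a) = 1024 := by
    have h1 : ∑ a, ∑ x, s x * s (bxor x a) = ∑ a ∈ R, 16384 * signOf (q zeroVec ^^ q a) := by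
      rw [← sum_filter_add_sum_filter_not univ (fun a => a ∈ R)]
      have hz : ∑ a ∈ univ.filter (fun a => a ∉ R), ∑ x, s x * s (bxor x a) = 0 :=
        sum_eq_zero fun a ha => hDoff a (mem_filter.1 ha).2
      rw [hz, add_zero]
      have hf : univ.filter (fun a => a ∈ R) = R := by ext a; simp
      rw [hf]
      exact sum_congr rfl fun a ha => hDon a ha
    rw [hDsum, ← mul_sum] at h1
    linarith
  have h0 : zeroVec ∈ R := by
    rw [hmemR]; intro b; rw [zeroVec_bxor]; cases q zeroVec <;> cases q b <;> rfl
  have hadd : ∀ a ∈ R, ∀ a' ∈ R, bxor a a' ∈ R := by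
    intro a ha a' ha'
    rw [hmemR] at ha ha' ⊢
    intro b
    rw [es_B_add_left q hq a a' b, ha b, ha' b]; rfl
  have hχ := sum_char_subspace hadd (fun a => signOf (q zeroVec ^^ q a))
    (fun a _ => by
      show signOf (q zeroVec ^^ q a) = 1 ∨ signOf (q zeroVec ^^ q a) = -1
      cases (q zeroVec ^^ q a) <;> simp [signOf])
    (fun a ha a' ha' => by
      show signOf (q zeroVec ^^ q (bxor a a')) = signOf (q zeroVec ^^ q a) * signOf (q zeroVec ^^ q a')
      have h : q (bxor a a') = (q zeroVec ^^ q a ^^ q a' ^^ (q zeroVec ^^ q a ^^ q a' ^^ q (bxor a a'))) := by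
        cases q zeroVec <;> cases q a <;> cases q a' <;> cases q (bxor a a') <;> rfl
      rw [(hmemR a).1 ha a'] at h
      rw [h, ← signOf_xor]
      congr 1
      cases q zeroVec <;> cases q a <;> cases q a' <;> rfl)
  have hRcard : #R = 1024 := by
    rcases hχ with h | h
    · rw [hchar] at h; exact_mod_cast h.symm
    · rw [hchar] at h; norm_num at h
  refine ⟨h0, hadd, hRcard, fun a ha x => ?_⟩
  have hall : ∀ a ∈ R, signOf (q zeroVec ^^ q a) = 1 := by
    have hz : ∑ a ∈ R, (1 - signOf (q zeroVec ^^ q a)) = 0 := by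
      rw [sum_sub_distrib, sum_const, hchar, hRcard]; norm_num
    have hnn : ∀ a ∈ R, 0 ≤ 1 - signOf (q zeroVec ^^ q a) := by
      intro a _; cases (q zeroVec ^^ q a) <;> simp [signOf]
    intro a ha
    have := (sum_eq_zero_iff_of_nonneg hnn).1 hz a ha
    linarith
  have h1 := hall a ha
  have hqa : (q zeroVec ^^ q a) = false := by
    revert h1; cases (q zeroVec ^^ q a) <;> norm_num [signOf]
  rw [hper0 a ha x, hqa, Bool.xor_false]

/-! ### The residual is multiplicative along parity periods -/

set_option maxHeartbeats 1600000 in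
/-- **Multiplicativity along periods.**  `g` cubic with `W_g = 64u'`, `#{u' odd} = 6144`, residual `e = u' − 2(−1)^f` equal to `±1`
on `P = {u' odd}` and `0` off `P`, and `R` a `⊕`-closed set of parity periods.  Then for `p ∈ P`, `r, r' ∈ R`:
`e(p ⊕ r ⊕ r')·e(p) = e(p ⊕ r)·e(p ⊕ r')`.  (Pigeonhole gives `t, t'` with `p⊕t, p⊕t', p⊕t⊕t' ∉ P`; the 4-flat `p ⊕ ⟨t,t',r,r'⟩`
has `4 ∣ Σ u'` by `fs_flat_sum_dvd`, its twelve `t`-translates are off `P` where `u' = 2(−1)^f`, and sixteen odd `(−1)^f` sum to an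
even number — so `4 ∣ e(p) + e(p⊕r) + e(p⊕r') + e(p⊕r⊕r')` with all four `±1`.) [this work] -/
theorem lsf_mul (f g : (Fin (7 + 7) → Bool) → Bool) (hg : IsDegLeFun 3 g)
    (u' : (Fin (7 + 7) → Bool) → ℤ) (hu' : ∀ x, W (fun y => signOf (g y)) x = (2 : ℝ) ^ 6 * (u' x : ℝ))
    (hPcard : #(univ.filter fun x : Fin (7 + 7) → Bool => Odd (u' x)) = 6144)
    (hon : ∀ x, Odd (u' x) → u' x - 2 * sZ (f x) = 1 ∨ u' x - 2 * sZ (f x) = -1)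
    (hoff : ∀ x, ¬ Odd (u' x) → u' x - 2 * sZ (f x) = 0)
    (R : Finset (Fin (7 + 7) → Bool)) (hRadd : ∀ a ∈ R, ∀ b ∈ R, bxor a b ∈ R)
    (hRinv : ∀ a ∈ R, ∀ x, Odd (u' (bxor x a)) ↔ Odd (u' x))
    (p : Fin (7 + 7) → Bool) (hp : Odd (u' p)) (r : Fin (7 + 7) → Bool) (hr : r ∈ R) (r' : Fin (7 + 7) → Bool) (hr' : r' ∈ R) :
    (u' (bxor p (bxor r r')) - 2 * sZ (f (bxor p (bxor r r')))) * (u' p - 2 * sZ (f p)) =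
      (u' (bxor p r) - 2 * sZ (f (bxor p r))) * (u' (bxor p r') - 2 * sZ (f (bxor p r'))) := by
  classical
  -- (1) two transversal directions `t, t'` with `p⊕t', p⊕t, p⊕t'⊕t ∉ P` (pigeonhole: `#P̄ = 10240 > 2¹³`)
  set Z := univ.filter (fun x : Fin (7 + 7) → Bool => ¬ Odd (u' x)) with hZdef
  have huniv : #(univ : Finset (Fin (7 + 7) → Bool)) = 16384 := by simp
  have hZcard : #Z = 10240 := by
    have h := card_filter_add_card_filter_not (s := (univ : Finset (Fin (7 + 7) → Bool))) (fun x => Odd (u' x))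
    rw [hPcard, huniv] at h
    simpa [hZdef] using (by omega : #(univ.filter fun x : Fin (7 + 7) → Bool => ¬ Odd (u' x)) = 10240)
  obtain ⟨x, hx⟩ : Z.Nonempty := card_pos.1 (by rw [hZcard]; norm_num)
  set Zp := Z.image (fun z => bxor p z) with hZp
  set Zx := Z.image (fun z => bxor x z) with hZx
  have hinj : ∀ c : Fin (7 + 7) → Bool, Function.Injective (fun z => bxor c z) := by
    intro c z₁ z₂ h
    have := congrArg (bxor c) h
    simpa only [bxor_bxor_cancel_left] using this
  have hZpcard : #Zp = 10240 := by rw [hZp, card_image_of_injective _ (hinj p), hZcard]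
  have hZxcard : #Zx = 10240 := by rw [hZx, card_image_of_injective _ (hinj x), hZcard]
  obtain ⟨t, ht⟩ : (Zp ∩ Zx).Nonempty := by
    rw [← card_pos]
    have h1 := card_union_add_card_inter Zp Zx
    have h2 : #(Zp ∪ Zx) ≤ 16384 := huniv ▸ card_le_univ _
    omega
  rw [mem_inter] at ht
  obtain ⟨z₁, hz₁, hz₁t⟩ := mem_image.1 ht.1
  obtain ⟨z₂, hz₂, hz₂t⟩ := mem_image.1 ht.2
  set t' := bxor p x with ht'
  have F1 : ¬ Odd (u' (bxor p t')) := by rw [ht', bxor_bxor_cancel_left]; exact (mem_filter.1 hx).2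
  have F2 : ¬ Odd (u' (bxor p t)) := by rw [← hz₁t, bxor_bxor_cancel_left]; exact (mem_filter.1 hz₁).2
  have F3 : ¬ Odd (u' (bxor (bxor p t') t)) := by
    rw [ht', bxor_bxor_cancel_left, ← hz₂t, bxor_bxor_cancel_left]; exact (mem_filter.1 hz₂).2
  have hoffR : ∀ y, ¬ Odd (u' y) → ∀ ρ ∈ R, ¬ Odd (u' (bxor y ρ)) := fun y hy ρ hρ h => hy ((hRinv ρ hρ y).1 h)
  have hz : ∀ y, ¬ Odd (u' y) → u' y - 2 * sZ (f y) = 0 := hoff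
  have h4 := fs_flat_sum_dvd (e := 2) g u' hg hu' p
    (Fin.cons t (Fin.cons t' (Fin.cons r (Fin.cons r' (fun i : Fin 0 => i.elim0) : Fin 1 → Fin (7 + 7) → Bool)
      : Fin 2 → Fin (7 + 7) → Bool) : Fin 3 → Fin (7 + 7) → Bool) : Fin 4 → Fin (7 + 7) → Bool) (by norm_num)
  have hsZ : (4 : ℤ) ∣ ∑ ε : Fin 4 → Bool, 2 * sZ (f (fun j => p j ^^ decide (Odd #(univ.filter fun i : Fin 4 => ε i &&
      (Fin.cons t (Fin.cons t' (Fin.cons r (Fin.cons r' (fun i : Fin 0 => i.elim0) : Fin 1 → Fin (7 + 7) → Bool)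
        : Fin 2 → Fin (7 + 7) → Bool) : Fin 3 → Fin (7 + 7) → Bool) : Fin 4 → Fin (7 + 7) → Bool) i j)))) := by
    have e1 : ∀ b : Bool, 2 * sZ b = 2 - 4 * (if b then 1 else 0 : ℤ) := by intro b; cases b <;> simp [sZ]
    simp_rw [e1]
    rw [sum_sub_distrib, sum_const, card_univ, Fintype.card_fun, Fintype.card_bool, Fintype.card_fin, ← mul_sum]
    exact ⟨8 - ∑ ε : Fin 4 → Bool, (if f (fun j => p j ^^ decide (Odd #(univ.filter fun i : Fin 4 => ε i &&
      (Fin.cons t (Fin.cons t' (Fin.cons r (Fin.cons r' (fun i : Fin 0 => i.elim0) : Fin 1 → Fin (7 + 7) → Bool)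
        : Fin 2 → Fin (7 + 7) → Bool) : Fin 3 → Fin (7 + 7) → Bool) : Fin 4 → Fin (7 + 7) → Bool) i j))) then 1 else 0 : ℤ),
      by norm_num; ring⟩
  have hδ : (4 : ℤ) ∣ ∑ ε : Fin 4 → Bool, (u' (fun j => p j ^^ decide (Odd #(univ.filter fun i : Fin 4 => ε i &&
      (Fin.cons t (Fin.cons t' (Fin.cons r (Fin.cons r' (fun i : Fin 0 => i.elim0) : Fin 1 → Fin (7 + 7) → Bool)
        : Fin 2 → Fin (7 + 7) → Bool) : Fin 3 → Fin (7 + 7) → Bool) : Fin 4 → Fin (7 + 7) → Bool) i j))) -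
      2 * sZ (f (fun j => p j ^^ decide (Odd #(univ.filter fun i : Fin 4 => ε i &&
      (Fin.cons t (Fin.cons t' (Fin.cons r (Fin.cons r' (fun i : Fin 0 => i.elim0) : Fin 1 → Fin (7 + 7) → Bool)
        : Fin 2 → Fin (7 + 7) → Bool) : Fin 3 → Fin (7 + 7) → Bool) : Fin 4 → Fin (7 + 7) → Bool) i j))))) := by
    rw [sum_sub_distrib]
    exact dvd_sub h4 hsZ
  simp only [tep_sum_split, Fintype.sum_unique, fl_pt_four, Bool.true_and, Bool.false_and, es_bxor_false,
    show (fun j => r j) = r from rfl, show (fun j => r' j) = r' from rfl, show (fun j => t j) = t from rfl,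
    show (fun j => t' j) = t' from rfl] at hδ
  have zA0 : u' (bxor p t') - 2 * sZ (f (bxor p t')) = 0 := hz _ F1
  have zA1 : u' (bxor (bxor p r') t') - 2 * sZ (f (bxor (bxor p r') t')) = 0 := by
    rw [dv_bxor_right_comm p r' t']; exact hz _ (hoffR _ F1 r' hr')
  have zA2 : u' (bxor (bxor p r) t') - 2 * sZ (f (bxor (bxor p r) t')) = 0 := by
    rw [dv_bxor_right_comm p r t']; exact hz _ (hoffR _ F1 r hr)
  have zA3 : u' (bxor (bxor (bxor p r') r) t') - 2 * sZ (f (bxor (bxor (bxor p r') r) t')) = 0 := by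
    rw [dv_bxor_right_comm (bxor p r') r t', dv_bxor_right_comm p r' t']
    exact hz _ (hoffR _ (hoffR _ F1 r' hr') r hr)
  have zB0 : u' (bxor p t) - 2 * sZ (f (bxor p t)) = 0 := hz _ F2
  have zB1 : u' (bxor (bxor p r') t) - 2 * sZ (f (bxor (bxor p r') t)) = 0 := by
    rw [dv_bxor_right_comm p r' t]; exact hz _ (hoffR _ F2 r' hr')
  have zB2 : u' (bxor (bxor p r) t) - 2 * sZ (f (bxor (bxor p r) t)) = 0 := by
    rw [dv_bxor_right_comm p r t]; exact hz _ (hoffR _ F2 r hr)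
  have zB3 : u' (bxor (bxor (bxor p r') r) t) - 2 * sZ (f (bxor (bxor (bxor p r') r) t)) = 0 := by
    rw [dv_bxor_right_comm (bxor p r') r t, dv_bxor_right_comm p r' t]
    exact hz _ (hoffR _ (hoffR _ F2 r' hr') r hr)
  have zC0 : u' (bxor (bxor p t') t) - 2 * sZ (f (bxor (bxor p t') t)) = 0 := hz _ F3
  have zC1 : u' (bxor (bxor (bxor p r') t') t) - 2 * sZ (f (bxor (bxor (bxor p r') t') t)) = 0 := by
    rw [dv_bxor_right_comm p r' t', dv_bxor_right_comm (bxor p t') r' t]; exact hz _ (hoffR _ F3 r' hr')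
  have zC2 : u' (bxor (bxor (bxor p r) t') t) - 2 * sZ (f (bxor (bxor (bxor p r) t') t)) = 0 := by
    rw [dv_bxor_right_comm p r t', dv_bxor_right_comm (bxor p t') r t]; exact hz _ (hoffR _ F3 r hr)
  have zC3 : u' (bxor (bxor (bxor (bxor p r') r) t') t) - 2 * sZ (f (bxor (bxor (bxor (bxor p r') r) t') t)) = 0 := by
    rw [dv_bxor_right_comm (bxor p r') r t', dv_bxor_right_comm p r' t', dv_bxor_right_comm (bxor (bxor p t') r') r t,
      dv_bxor_right_comm (bxor p t') r' t]
    exact hz _ (hoffR _ (hoffR _ F3 r' hr') r hr)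
  rw [zA0, zA1, zA2, zA3, zB0, zB1, zB2, zB3, zC0, zC1, zC2, zC3] at hδ
  -- (4) the four residuals on `P` are `±1` with sum `≡ 0 (mod 4)`
  have o1 : Odd (u' (bxor p r')) := (hRinv r' hr' p).2 hp
  have o2 : Odd (u' (bxor p r)) := (hRinv r hr p).2 hp
  have o3 : Odd (u' (bxor p (bxor r r'))) := (hRinv _ (hRadd r hr r' hr') p).2 hp
  have e3 : bxor (bxor p r') r = bxor p (bxor r r') := by rw [iw_bxor_assoc, bxor_comm r' r]
  rw [e3] at hδ
  have hδ' : (4 : ℤ) ∣ (u' p - 2 * sZ (f p)) + (u' (bxor p r') - 2 * sZ (f (bxor p r'))) +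
      (u' (bxor p r) - 2 * sZ (f (bxor p r))) + (u' (bxor p (bxor r r')) - 2 * sZ (f (bxor p (bxor r r')))) := by
    omega
  rcases hon p hp with h0 | h0 <;> rcases hon _ o1 with h1 | h1 <;> rcases hon _ o2 with h2 | h2 <;>
    rcases hon _ o3 with h3 | h3 <;> simp only [h0, h1, h2, h3] at hδ' ⊢ <;> omega

/-! ### The Fourier `ℓ¹` bound -/

set_option maxHeartbeats 1600000 in
/-- **`ℓ¹` bound.**  Under the hypotheses of `lsf_mul` (with `R` the radical of the parity quadratic, `#R = 2¹⁰` by `lsf_radical`):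
`Σ_y |ê(y)| ≤ 6·2¹⁴`.  (On each coset `p ⊕ R ⊆ P` the residual is a period-up-to-sign pattern, so `fp_l1_sq_mul_le` bounds the
`ℓ¹`-norm of the transform of `e·1_{p⊕R}` by `2¹⁴`; and `2¹⁰·e = Σ_{p∈P} e·1_{p⊕R}`.)  NOT summit progress. [this work] -/
theorem lsf_l1 (f g : (Fin (7 + 7) → Bool) → Bool) (hg : IsDegLeFun 3 g)
    (u' : (Fin (7 + 7) → Bool) → ℤ) (hu' : ∀ x, W (fun y => signOf (g y)) x = (2 : ℝ) ^ 6 * (u' x : ℝ))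
    (hPcard : #(univ.filter fun x : Fin (7 + 7) → Bool => Odd (u' x)) = 6144)
    (hon : ∀ x, Odd (u' x) → u' x - 2 * sZ (f x) = 1 ∨ u' x - 2 * sZ (f x) = -1)
    (hoff : ∀ x, ¬ Odd (u' x) → u' x - 2 * sZ (f x) = 0) :
    ∑ y, |W (fun x => ((u' x - 2 * sZ (f x) : ℤ) : ℝ)) y| ≤ 6 * 2 ^ 14 := by
  classical
  set q : (Fin (7 + 7) → Bool) → Bool := fun x => decide (Odd (u' x)) with hqdef
  have hq : IsDegLeFun 2 q := stub_walshTower stub_axParity (7 + 7) 6 2 g u' hg hu' (by intro k hk hkn; omega)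
  have hfilt : (univ.filter fun x : Fin (7 + 7) → Bool => q x = true) = univ.filter fun x => Odd (u' x) :=
    filter_congr fun x _ => by rw [hqdef, decide_eq_true_iff]
  obtain ⟨h0, hadd, hRcard, hRper⟩ := lsf_radical q hq (by rw [hfilt]; exact hPcard)
  set R := univ.filter (fun a : Fin (7 + 7) → Bool => ∀ b, (q zeroVec ^^ q a ^^ q b ^^ q (bxor a b)) = false) with hRdef
  have hRinv : ∀ a ∈ R, ∀ x, Odd (u' (bxor x a)) ↔ Odd (u' x) := by
    intro a ha x
    have h := hRper a ha x
    simp only [hqdef] at h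
    rwa [decide_eq_decide] at h
  set E : (Fin (7 + 7) → Bool) → ℝ := fun x => ((u' x - 2 * sZ (f x) : ℤ) : ℝ) with hEdef
  have hE_on : ∀ x, Odd (u' x) → E x = 1 ∨ E x = -1 := by
    intro x hx
    rcases hon x hx with h | h
    · left; simp only [hEdef, h]; norm_num
    · right; simp only [hEdef, h]; norm_num
  have hE_off : ∀ x, ¬ Odd (u' x) → E x = 0 := by
    intro x hx; simp only [hEdef, hoff x hx]; norm_num
  have hmul : ∀ p, Odd (u' p) → ∀ r ∈ R, ∀ r' ∈ R, E (bxor p (bxor r r')) * E p = E (bxor p r) * E (bxor p r') := by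
    intro p hp r hr r' hr'
    have h := lsf_mul f g hg u' hu' hPcard hon hoff R hadd hRinv p hp r hr r' hr'
    simp only [hEdef]
    exact_mod_cast h
  let A : (Fin (7 + 7) → Bool) → (Fin (7 + 7) → Bool) → ℝ := fun p x => if bxor p x ∈ R then E x else 0
  have hinj : ∀ c : Fin (7 + 7) → Bool, Function.Injective (fun z => bxor c z) := by
    intro c z₁ z₂ h
    have := congrArg (bxor c) h
    simpa only [bxor_bxor_cancel_left] using this
  have hSeq : ∀ p, (univ.filter fun x : Fin (7 + 7) → Bool => bxor p x ∈ R) = R.image (fun z => bxor p z) := by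
    intro p; ext x
    simp only [mem_filter, mem_univ, true_and, mem_image]
    constructor
    · intro h; exact ⟨bxor p x, h, bxor_bxor_cancel_left p x⟩
    · rintro ⟨z, hz, rfl⟩; rwa [bxor_bxor_cancel_left]
  have hScard : ∀ p, #(univ.filter fun x : Fin (7 + 7) → Bool => bxor p x ∈ R) = 1024 := by
    intro p; rw [hSeq p, card_image_of_injective _ (hinj p), hRcard]
  have hl1p : ∀ p, Odd (u' p) → ∑ y, |W (A p) y| ≤ 2 ^ 14 := by
    intro p hp
    have hA1 : ∀ x ∈ (univ.filter fun x : Fin (7 + 7) → Bool => bxor p x ∈ R), A p x = 1 ∨ A p x = -1 := by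
      intro x hx
      have hx' : bxor p x ∈ R := (mem_filter.1 hx).2
      have hox : Odd (u' x) := by
        have h := (hRinv _ hx' p).2 hp
        rwa [bxor_bxor_cancel_left] at h
      simp only [A, if_pos hx']
      exact hE_on x hox
    have hA0 : ∀ x, x ∉ (univ.filter fun x : Fin (7 + 7) → Bool => bxor p x ∈ R) → A p x = 0 := by
      intro x hx
      have hx' : bxor p x ∉ R := fun h => hx (mem_filter.2 ⟨mem_univ _, h⟩)
      simp only [A, if_neg hx']
    have hper : ∀ a ∈ R, ∃ c : ℝ, (c = 1 ∨ c = -1) ∧ ∀ x, A p (bxor x a) = c * A p x := by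
      intro a ha
      have hoa : Odd (u' (bxor p a)) := (hRinv a ha p).2 hp
      refine ⟨E (bxor p a) * E p, ?_, fun x => ?_⟩
      · rcases hE_on _ hoa with h | h <;> rcases hE_on p hp with h' | h' <;> rw [h, h'] <;> norm_num
      · by_cases hx : bxor p x ∈ R
        · have hxa : bxor p (bxor x a) ∈ R := by rw [← iw_bxor_assoc]; exact hadd _ hx _ ha
          simp only [A, if_pos hx, if_pos hxa]
          have key := hmul p hp (bxor p x) hx a ha
          rw [← iw_bxor_assoc, bxor_bxor_cancel_left] at key
          have hpp : E p * E p = 1 := by rcases hE_on p hp with h | h <;> rw [h] <;> norm_num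
          linear_combination (E p) * key - (E (bxor x a)) * hpp
        · have hxa : bxor p (bxor x a) ∉ R := by
            intro h
            apply hx
            have h2 := hadd _ h _ ha
            rwa [iw_bxor_assoc, iw_bxor_assoc, bxor_self, bxor_zeroVec] at h2
          simp only [A, if_neg hx, if_neg hxa, mul_zero]
    have h := fp_l1_sq_mul_le (A p) _ R hA1 hA0 h0 hadd hper
    rw [hRcard, hScard p] at h
    have hs0 : 0 ≤ ∑ y, |W (A p) y| := sum_nonneg fun y _ => abs_nonneg _
    have h2 : (∑ y, |W (A p) y|) ^ 2 ≤ (2 : ℝ) ^ 28 := by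
      norm_num at h
      nlinarith [h]
    nlinarith [h2, hs0, sq_nonneg (∑ y, |W (A p) y| - 2 ^ 14)]
  set Pset := univ.filter (fun x : Fin (7 + 7) → Bool => Odd (u' x)) with hPset
  have havg : ∀ x, (1024 : ℝ) * E x = ∑ p ∈ Pset, A p x := by
    intro x
    by_cases hx : Odd (u' x)
    · have hTeq : Pset.filter (fun p => bxor p x ∈ R) = R.image (fun z => bxor x z) := by
        ext p
        simp only [mem_filter, hPset, mem_univ, true_and, mem_image]
        constructor
        · rintro ⟨-, h⟩
          exact ⟨bxor p x, h, by rw [bxor_comm p x, bxor_bxor_cancel_left]⟩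
        · rintro ⟨z, hz, rfl⟩
          refine ⟨(hRinv z hz x).2 hx, ?_⟩
          rw [dv_bxor_right_comm x z x, bxor_self, zeroVec_bxor]; exact hz
      have h1 : ∑ p ∈ Pset, A p x = ∑ p ∈ Pset.filter (fun p => bxor p x ∈ R), E x :=
        (sum_filter (fun p => bxor p x ∈ R) (fun _ => E x)).symm
      rw [h1, sum_const, hTeq, card_image_of_injective _ (hinj x), hRcard, nsmul_eq_mul]
      norm_num
    · rw [hE_off x hx, mul_zero]
      symm
      refine sum_eq_zero fun p _ => ?_
      simp only [A, hE_off x hx, ite_self]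
  have hWavg : ∀ y, (1024 : ℝ) * W E y = ∑ p ∈ Pset, W (A p) y := by
    intro y
    unfold W
    rw [mul_sum]
    have e : ∀ x, (1024 : ℝ) * (E x * twist x y) = ∑ p ∈ Pset, A p x * twist x y := by
      intro x; rw [← mul_assoc, havg x, sum_mul]
    rw [sum_congr rfl fun x _ => e x, sum_comm]
  have hb : ∀ y, (1024 : ℝ) * |W E y| ≤ ∑ p ∈ Pset, |W (A p) y| := by
    intro y
    rw [← abs_of_pos (by norm_num : (0 : ℝ) < 1024), ← abs_mul, hWavg y]
    exact abs_sum_le_sum_abs _ _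
  have htot : (1024 : ℝ) * ∑ y, |W E y| ≤ ∑ p ∈ Pset, ∑ y, |W (A p) y| := by
    rw [mul_sum, sum_comm]
    exact sum_le_sum fun y _ => hb y
  have hsum : ∑ p ∈ Pset, ∑ y, |W (A p) y| ≤ 6144 * 2 ^ 14 := by
    calc ∑ p ∈ Pset, ∑ y, |W (A p) y| ≤ ∑ p ∈ Pset, (2 : ℝ) ^ 14 := sum_le_sum fun p hp => hl1p p (mem_filter.1 hp).2
      _ = 6144 * 2 ^ 14 := by rw [sum_const, hPcard, nsmul_eq_mul]; norm_num
  linarith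

end Summit.QuantumAdvantage.QuantumAdvantage.Theorems.NearExactIsExact.Negative.LevelSixFullCore

end
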